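import Mathlib
import Summits.NavierStokesRegularity.NavierStokesRegularity.Theorems.OrthantWakeOrthantTableStructure
import Summits.NavierStokesRegularity.NavierStokesRegularity.Theorems.SubOnsagerCeilingDefs
import HarnessLib

/-!
# RELEASE TRIADS EXIST IN THE CRUX'S CLASS: an orthant KP network proper whose dead-end pocket RETURNS energy in-shell
# (census evidence for the crux `SubOnsagerCeiling.ForwardTailCeilingKP`, stmt-NavierStokesRegularity-27057, `--supports`)

Every def-free corner of the registered stubs landed so far (pair slaving, side-branch regions, energy starvation in all its forms,
`Theorems/SubOnsagerCeilingKP*`) assumes «no differential triads»: `α a b d (0,0,0) = 0` for `a, b, d` distinct.  This file records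
that the hypothesis is a GENUINE RESTRICTION of the crux's class — `E₂(R)`, ORTHANT, DIAGONAL feeds — and what it excludes:

* `releaseTriad_nonempty` — there is a table of `E₂(4)`, orthant, with diagonal feeds (the Katz–Pavlović chain on mode `0`, weight
  `1/2`; in-shell pumps `0 → 3`, `1 → 3` of weight `1`) carrying the DIFFERENTIAL TRIAD `α 0 1 3 (0,0,0) = α 1 0 3 (0,0,0) = −1/2`,
  `α 0 3 1 = α 3 0 1 = α 1 3 0 = α 3 1 0 = 1/4`: in shell, `x₃' ∋ −Λ x₀x₁`, `x₀' ∋ +½Λ x₁x₃`, `x₁' ∋ +½Λ x₀x₃` — the «dead-end» pocket `3`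
  RELEASES energy back to the live modes at the rate `Λₙ x₀x₁x₃` (a park-and-release channel).  The orthant (Kamke) condition allows
  the negative target coefficient because it only asks the in-shell form of the pocket to be COPOSITIVE on the face `y₃ = 0`
  (`y₀² + y₁² − y₀y₁ ≥ 0`): release triads are admissible exactly when MASKED BY PUMPS into the same pocket
  (`orthant_iff_coefficients`, clause (3)).

Consequence for the repair census: «pocket forward-dead and pump-dead ⇒ pocket only accumulates» is not a class-wide fact; networks with
masked release triads are covered by NO landed corner at any scale ratio, and belong on the remaining list beside the small-ratio chain.
HONEST FRAMING: MODEL lattice algebra (route SubOnsagerCeiling, rung TL-M2Break); a non-vacuity statement about the hypotheses of the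
crux, proving nothing about the stubs, the crux or Navier–Stokes regularity. [cite: Tao2016AveragedNS, §4 (4.2)–(4.3)]
-/

noncomputable section

-- the sub-problem namespace `NavierStokesRegularity.NavierStokesRegularity` is the tree's layout (D-0017)
set_option linter.dupNamespace false

namespace Summit.NavierStokesRegularity.NavierStokesRegularity.Theorems

open Literature.Analysis.FluidPDE.TaoCascade

section ReleaseTriad

variable {α : Fin 4 → Fin 4 → Fin 4 → ℤ × ℤ × ℤ → ℝ}
  (hfeed : ∀ i₁ i₂ i₃ : Fin 4, α i₁ i₂ i₃ ((0 : ℤ), (0 : ℤ), (1 : ℤ)) =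
      if i₁ = i₂ ∧ i₁ = 0 ∧ i₃ = 0 then (1 / 2 : ℝ) else 0)
  (hup1 : ∀ i₁ i₂ i₃ : Fin 4, α i₁ i₂ i₃ ((1 : ℤ), (0 : ℤ), (0 : ℤ)) =
      if i₂ = i₃ ∧ i₂ = 0 ∧ i₁ = 0 then (-(1 / 4) : ℝ) else 0)
  (hup2 : ∀ i₁ i₂ i₃ : Fin 4, α i₁ i₂ i₃ ((0 : ℤ), (1 : ℤ), (0 : ℤ)) =
      if i₁ = i₃ ∧ i₁ = 0 ∧ i₂ = 0 then (-(1 / 4) : ℝ) else 0)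
  (hin : ∀ i₁ i₂ i₃ : Fin 4, α i₁ i₂ i₃ ((0 : ℤ), (0 : ℤ), (0 : ℤ)) =
      (if i₁ = i₂ ∧ (i₁ = 0 ∨ i₁ = 1) ∧ i₃ = 3 then (1 : ℝ) else 0) +
        (if i₂ = 3 ∧ i₃ = i₁ ∧ (i₁ = 0 ∨ i₁ = 1) then -(1 / 2) else 0) +
        (if i₁ = 3 ∧ i₃ = i₂ ∧ (i₂ = 0 ∨ i₂ = 1) then -(1 / 2) else 0) +
        (if ((i₁ = 0 ∧ i₂ = 1) ∨ (i₁ = 1 ∧ i₂ = 0)) ∧ i₃ = 3 then -(1 / 2) else 0) +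
        (if ((i₁ = 0 ∧ i₂ = 3) ∨ (i₁ = 3 ∧ i₂ = 0)) ∧ i₃ = 1 then (1 / 4) else 0) +
        (if ((i₁ = 1 ∧ i₂ = 3) ∨ (i₁ = 3 ∧ i₂ = 1)) ∧ i₃ = 0 then (1 / 4) else 0))
include hfeed hup1 hup2 hin

/-- Symmetry (4.2) and cancellation (4.3) of the release-triad table. [this file] -/
theorem releaseTriad_symmCanc : (IsSymmetricCoeff α ∧ IsCancellingCoeff α) ∧ α 0 1 3 (0, 0, 0) = -(1 / 2) := by
  refine ⟨⟨?_, ?_⟩, by rw [hin]; simp⟩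
  · intro i₁ i₂ i₃ μ₁ μ₂ μ₃ hμ
    rw [mem_shiftSet_iff] at hμ
    simp only [Prod.mk.injEq] at hμ
    rcases hμ with ⟨rfl, rfl, rfl⟩ | ⟨rfl, rfl, rfl⟩ | ⟨rfl, rfl, rfl⟩ | ⟨rfl, rfl, rfl⟩
    · simp only [hin]
      fin_cases i₁ <;> fin_cases i₂ <;> fin_cases i₃ <;> simp
    · simp only [hup1, hup2]
    · simp only [hup1, hup2]
    · simp only [hfeed]
      fin_cases i₁ <;> fin_cases i₂ <;> fin_cases i₃ <;> simp
  · intro i₁ i₂ i₃ μ₁ μ₂ μ₃ hμ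
    rw [mem_shiftSet_iff] at hμ
    simp only [Prod.mk.injEq] at hμ
    rcases hμ with ⟨rfl, rfl, rfl⟩ | ⟨rfl, rfl, rfl⟩ | ⟨rfl, rfl, rfl⟩ | ⟨rfl, rfl, rfl⟩ <;>
      simp only [hin, hfeed, hup1, hup2] <;>
      fin_cases i₁ <;> fin_cases i₂ <;> fin_cases i₃ <;> simp <;> norm_num

/-- `4`-comparability of the release-triad table. [this file] -/
theorem releaseTriad_comparable : IsComparableCoeff 4 α ∧ α 0 1 3 (0, 0, 0) = -(1 / 2) := by
  refine ⟨?_, by rw [hin]; simp⟩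
  intro i₁ i₂ i₃ μ hμ
  rw [mem_shiftSet_iff] at hμ
  rcases hμ with rfl | rfl | rfl | rfl <;>
    simp only [hin, hfeed, hup1, hup2] <;>
    fin_cases i₁ <;> fin_cases i₂ <;> fin_cases i₃ <;> simp <;> norm_num

/-- The orthant (Kamke) hypothesis of the crux for the release-triad table, via `orthant_iff_coefficients`: the pocket's in-shell form
`y₀² + y₁² − y₀y₁` is copositive on `y₃ = 0`, the live forms are `½y₁y₃`, `½y₀y₃ ≥ 0` on their faces. [this file] -/
theorem releaseTriad_orthant :
    (∀ (Y : Fin 4 → ℤ → ℝ → ℝ) (τ : ℝ), (∀ (j : Fin 4) (k : ℤ), 1 ≤ k → 0 ≤ Y j k τ) →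
      ∀ δ : ℝ, 0 < δ → ∀ (i : Fin 4) (n : ℤ), 1 ≤ n → Y i n τ = 0 → 0 ≤ quadTerm δ α Y i n τ) ∧
      α 0 1 3 (0, 0, 0) = -(1 / 2) := by
  refine ⟨?_, by rw [hin]; simp⟩
  rw [orthant_iff_coefficients]
  refine ⟨?_, ?_, ?_⟩
  · intro i y
    simp only [hfeed, Fin.sum_univ_four]
    fin_cases i
    · simp
      exact mul_self_nonneg _
    · simp
    · simp
    · simp
  · intro i a b hbi
    simp only [hup1, hup2]
    fin_cases i <;> fin_cases a <;> fin_cases b <;> simp at hbi ⊢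
  · intro i y hy hyi
    have hy0 := hy 0
    have hy1 := hy 1
    have hy3 := hy 3
    simp only [hin, Fin.sum_univ_four]
    fin_cases i
    · have h0 : y 0 = 0 := hyi
      simp [h0]
      nlinarith [mul_nonneg hy1 hy3]
    · have h1 : y 1 = 0 := hyi
      simp [h1]
      nlinarith [mul_nonneg hy0 hy3]
    · simp
    · have h3 : y 3 = 0 := hyi
      simp [h3]
      nlinarith [sq_nonneg (y 0 - y 1), mul_nonneg hy0 hy1]

omit hup1 hup2 in
/-- Structure of the release-triad table: diagonal feeds; the pocket `3` feeds nothing forward and is fed by nothing forward; pumps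
`0 → 3`, `1 → 3`; and the release triad with its two back-reaction slots. [this file] -/
theorem releaseTriad_structure :
    (∀ a b i : Fin 4, a ≠ b → α a b i (0, 0, 1) = 0) ∧ (∀ e : Fin 4, α 3 3 e (0, 0, 1) = 0) ∧ (∀ a : Fin 4, α a a 3 (0, 0, 1) = 0) ∧
      α 0 0 0 (0, 0, 1) = 1 / 2 ∧ α 0 0 3 (0, 0, 0) = 1 ∧ α 1 1 3 (0, 0, 0) = 1 ∧
      α 0 1 3 (0, 0, 0) = -(1 / 2) ∧ α 1 3 0 (0, 0, 0) = 1 / 4 ∧ α 0 3 1 (0, 0, 0) = 1 / 4 := by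
  refine ⟨?_, ?_, ?_, ?_, ?_, ?_, ?_, ?_, ?_⟩
  · intro a b i hab
    rw [hfeed]
    simp [hab]
  · intro e; rw [hfeed]; simp
  · intro a; rw [hfeed]; fin_cases a <;> simp
  · rw [hfeed]; simp
  · rw [hin]; simp
  · rw [hin]; simp
  · rw [hin]; simp
  · rw [hin]; simp
  · rw [hin]; simp

end ReleaseTriad

/-- **RELEASE TRIADS EXIST IN THE CRUX'S CLASS.**  There is a table `α ∈ E₂(4)` satisfying the orthant hypothesis of the crux and the
diagonal-feed clause — the KP chain on mode `0` (weight `1/2`) with in-shell pumps `0 → 3`, `1 → 3` (weight `1`) into a pocket `3` that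
feeds nothing and is fed by nothing forward — which carries the differential («release») triad `α 0 1 3 (0,0,0) = −1/2` with back-reaction
slots `α 1 3 0 (0,0,0) = α 0 3 1 (0,0,0) = 1/4`: the pocket returns energy in-shell to the live modes `0, 1` at the rate `Λₙ x₀x₁x₃`.  Hence
the hypothesis «no differential triads» of every landed def-free corner is a genuine restriction of the class. [this file] -/
theorem releaseTriad_nonempty : ∃ α : Fin 4 → Fin 4 → Fin 4 → ℤ × ℤ × ℤ → ℝ,
    Literature.Analysis.FluidPDE.TaoCascade.InTableClass 4 α ∧
    (∀ (Y : Fin 4 → ℤ → ℝ → ℝ) (τ : ℝ), (∀ (j : Fin 4) (k : ℤ), 1 ≤ k → 0 ≤ Y j k τ) →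
      ∀ δ : ℝ, 0 < δ → ∀ (i : Fin 4) (n : ℤ), 1 ≤ n → Y i n τ = 0 → 0 ≤ quadTerm δ α Y i n τ) ∧
    (∀ a b i : Fin 4, a ≠ b → α a b i (0, 0, 1) = 0) ∧
    (∀ e : Fin 4, α 3 3 e (0, 0, 1) = 0) ∧ (∀ a : Fin 4, α a a 3 (0, 0, 1) = 0) ∧
    α 0 0 0 (0, 0, 1) = 1 / 2 ∧ α 0 0 3 (0, 0, 0) = 1 ∧ α 1 1 3 (0, 0, 0) = 1 ∧
    α 0 1 3 (0, 0, 0) = -(1 / 2) ∧ α 1 3 0 (0, 0, 0) = 1 / 4 ∧ α 0 3 1 (0, 0, 0) = 1 / 4 := by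
  set α : Fin 4 → Fin 4 → Fin 4 → ℤ × ℤ × ℤ → ℝ := fun i₁ i₂ i₃ μ =>
    if μ = ((0 : ℤ), (0 : ℤ), (1 : ℤ)) then
      (if i₁ = i₂ ∧ i₁ = 0 ∧ i₃ = 0 then (1 / 2 : ℝ) else 0)
    else if μ = ((1 : ℤ), (0 : ℤ), (0 : ℤ)) then
      (if i₂ = i₃ ∧ i₂ = 0 ∧ i₁ = 0 then (-(1 / 4) : ℝ) else 0)
    else if μ = ((0 : ℤ), (1 : ℤ), (0 : ℤ)) then
      (if i₁ = i₃ ∧ i₁ = 0 ∧ i₂ = 0 then (-(1 / 4) : ℝ) else 0)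
    else if μ = ((0 : ℤ), (0 : ℤ), (0 : ℤ)) then
      ((if i₁ = i₂ ∧ (i₁ = 0 ∨ i₁ = 1) ∧ i₃ = 3 then (1 : ℝ) else 0) +
        (if i₂ = 3 ∧ i₃ = i₁ ∧ (i₁ = 0 ∨ i₁ = 1) then -(1 / 2) else 0) +
        (if i₁ = 3 ∧ i₃ = i₂ ∧ (i₂ = 0 ∨ i₂ = 1) then -(1 / 2) else 0) +
        (if ((i₁ = 0 ∧ i₂ = 1) ∨ (i₁ = 1 ∧ i₂ = 0)) ∧ i₃ = 3 then -(1 / 2) else 0) +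
        (if ((i₁ = 0 ∧ i₂ = 3) ∨ (i₁ = 3 ∧ i₂ = 0)) ∧ i₃ = 1 then (1 / 4) else 0) +
        (if ((i₁ = 1 ∧ i₂ = 3) ∨ (i₁ = 3 ∧ i₂ = 1)) ∧ i₃ = 0 then (1 / 4) else 0))
    else 0 with hα
  have hfeed : ∀ i₁ i₂ i₃ : Fin 4, α i₁ i₂ i₃ ((0 : ℤ), (0 : ℤ), (1 : ℤ)) =
      if i₁ = i₂ ∧ i₁ = 0 ∧ i₃ = 0 then (1 / 2 : ℝ) else 0 := fun _ _ _ => by simp [hα]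
  have hup1 : ∀ i₁ i₂ i₃ : Fin 4, α i₁ i₂ i₃ ((1 : ℤ), (0 : ℤ), (0 : ℤ)) =
      if i₂ = i₃ ∧ i₂ = 0 ∧ i₁ = 0 then (-(1 / 4) : ℝ) else 0 := fun _ _ _ => by simp [hα]
  have hup2 : ∀ i₁ i₂ i₃ : Fin 4, α i₁ i₂ i₃ ((0 : ℤ), (1 : ℤ), (0 : ℤ)) =
      if i₁ = i₃ ∧ i₁ = 0 ∧ i₂ = 0 then (-(1 / 4) : ℝ) else 0 := fun _ _ _ => by simp [hα]
  have hin : ∀ i₁ i₂ i₃ : Fin 4, α i₁ i₂ i₃ ((0 : ℤ), (0 : ℤ), (0 : ℤ)) =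
      (if i₁ = i₂ ∧ (i₁ = 0 ∨ i₁ = 1) ∧ i₃ = 3 then (1 : ℝ) else 0) +
        (if i₂ = 3 ∧ i₃ = i₁ ∧ (i₁ = 0 ∨ i₁ = 1) then -(1 / 2) else 0) +
        (if i₁ = 3 ∧ i₃ = i₂ ∧ (i₂ = 0 ∨ i₂ = 1) then -(1 / 2) else 0) +
        (if ((i₁ = 0 ∧ i₂ = 1) ∨ (i₁ = 1 ∧ i₂ = 0)) ∧ i₃ = 3 then -(1 / 2) else 0) +
        (if ((i₁ = 0 ∧ i₂ = 3) ∨ (i₁ = 3 ∧ i₂ = 0)) ∧ i₃ = 1 then (1 / 4) else 0) +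
        (if ((i₁ = 1 ∧ i₂ = 3) ∨ (i₁ = 3 ∧ i₂ = 1)) ∧ i₃ = 0 then (1 / 4) else 0) := fun _ _ _ => by simp [hα]
  obtain ⟨⟨hsymm, hcanc⟩, -⟩ := releaseTriad_symmCanc hfeed hup1 hup2 hin
  obtain ⟨hcomp, -⟩ := releaseTriad_comparable hfeed hup1 hup2 hin
  obtain ⟨horth, -⟩ := releaseTriad_orthant hfeed hup1 hup2 hin
  obtain ⟨hD, h3w, hw3, h00, hP0, hP1, hrel, hb0, hb1⟩ := releaseTriad_structure hfeed hin
  exact ⟨α, ⟨hsymm, hcanc, hcomp⟩, horth, hD, h3w, hw3, h00, hP0, hP1, hrel, hb0, hb1⟩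

end Summit.NavierStokesRegularity.NavierStokesRegularity.Theorems

end
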